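import Literature.NumberTheory.AdelicBaseChange.CompletionBaseChange
import Mathlib.NumberTheory.Padics.HeightOneSpectrum
import Mathlib.NumberTheory.NumberField.Cyclotomic.Ideal
import Mathlib.NumberTheory.Cyclotomic.Basic
import HarnessLib

/-!
# Completions of a cyclotomic field: `ℚ(ζ_m)_w / ℚ_v` is cyclotomic, Galois, and unramified at `p ∤ m`

`Proofs` file (theorems only — no definition, no instance, no named fact) in topic
`NumberTheory/AdelicBaseChange`, continuing the vendored FLT packet `CompletionBaseChange`
(`IsDedekindDomain.HeightOneSpectrum.Extension`, the `K_v`-algebra structure on `L_w` for `w ∣ v`,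
and the local base change `L ⊗[K] K_v ≃ₐ[L] ∏_{w ∣ v} L_w`, Cassels–Fröhlich II §10 (10.2)).

For a number field `L` with `IsCyclotomicExtension {m} ℚ L` (e.g. `L = CyclotomicField m ℚ`), a
finite place `v` of `ℚ` and a place `w : v.Extension (𝓞 L)` above it, write `L_w = w.1.adicCompletion L`
and `ℚ_v = v.adicCompletion ℚ`.  We prove:

* `adjoin_rootsOfUnity_adicCompletion_eq_top`, `isCyclotomicExtension_adicCompletion` —
  **`L_w = ℚ_v(μ_m)` is a cyclotomic extension of `ℚ_v`** (`L` spans `L_w` over `ℚ_v` by the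
  surjectivity of the packet's base change, and `L = ℚ(μ_m)`); hence
  `isGalois_adicCompletion` — **`L_w / ℚ_v` is Galois** (Neukirch, *Algebraic Number Theory*,
  Ch. II §8, p. 161: `L_w = L K_v`; Ch. II (7.12): `K(ζ_n)/K` for `(n, p) = 1`).
* `intValuation_natCast_eq_exp_neg_one_of_not_dvd`, `valued_natCast_adicCompletion_eq_exp_neg_one_of_not_dvd`
  — for a prime `p ∤ m` and any place `w ∋ p` of `L`: **`v_w(p) = exp (−1)`**, i.e. `p` is a
  uniformiser of `L_w` (`w ∣ p` is UNRAMIFIED in `ℚ(μ_m)`: Mathlib's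
  `IsCyclotomicExtension.Rat.ramificationIdx_eq_of_not_dvd`, read through
  `Ideal.IsDedekindDomain.ramificationIdx_eq_multiplicity` and
  `HeightOneSpectrum.intValuation_eq_exp_neg_multiplicity`); consequently
  `valued_le_valued_natCast_of_lt_one_of_not_dvd` — **`v_w(x) < 1 → v_w(x) ≤ v_w(p)`** for all
  `x : L_w`, the `Valued` form of the hypothesis "`‖x‖ < 1 → ‖x‖ ≤ ‖p‖`" (value group generated by
  `‖p‖`) under which the tree's K-port of the formal-group logarithm is written
  (`Summit.…Theorems.KPort.consumer_of_addv`), and the `Extension` forms of both at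
  `v = primesEquiv.symm p` (Neukirch Ch. I (10.3)–(10.4): `p ∤ m` is unramified in `ℚ(μ_m)`;
  Ch. II (7.12) (i): `K(ζ_n)/K` is unramified for `(n, p) = 1`).
* §3: the four statements re-exported at `L = CyclotomicField m ℚ` (instance discharged), the
  currency of the tree's consumers.

Motivation (cell `bsd-addord`, crux `KatoKuriharaPortThreeShared`, registered stub `hKloc` clauses
(d)/(e)): the per-factor statements live in the completions `L_w` of `L = ℚ(ζ_m)` at `w ∣ 3`, and
the K-port consumer is stated for an abstract complete field `K ⊇ ℚ_p` that is Galois, finite and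
unramified over `ℚ_p`; this file supplies exactly those three properties of `L_w` (for `p ∤ m`).
Nothing here is specific to elliptic curves.

## References
* [NeukirchANT1999] J. Neukirch, *Algebraic Number Theory*, Springer (1999), Ch. I (10.3)–(10.4)
  (decomposition of primes in `ℚ(ζ_n)`), Ch. II (7.12)–(7.13) (cyclotomic extensions of a local
  field), Ch. II §8, p. 161 (completions `L_w = L K_v` of a global extension).
* [CasselsFrohlichANT1967] J. W. S. Cassels, A. Fröhlich (eds.), *Algebraic Number Theory* (1967),
  Ch. II §10 (10.2).
* [FLTProject2025] the FLT project, `FLT/DedekindDomain/Completion/BaseChange.lean` (vendored packet).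

## Design
Theorems only (plumbing steps are `private`); the `ℚ_v`-algebra structure on `L_w` is the packet's instance
(`Extension.adicCompletionSemialgHom … |>.toAlgebra`), the one the consumers
(`Literature.NumberTheory.AdelicBaseChange.exists_padicTensorAlgEquiv`, the Summits-side `hKloc`) use.
`noncomputable section`; axioms standard.
-/

noncomputable section

open scoped NumberField WithZero
open IsDedekindDomain NumberField

namespace Literature.NumberTheory.AdelicBaseChange

/-! ## §1 `L_w / ℚ_v` is cyclotomic, hence Galois -/

section Cyclotomic

variable (L : Type*) [Field L] [NumberField L] (m : ℕ) [NeZero m] [IsCyclotomicExtension {m} ℚ L]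
variable (v : HeightOneSpectrum (𝓞 ℚ)) (w : v.Extension (𝓞 L))

/-- The image in `L_w` of the distinguished primitive `m`-th root of unity `ζ_m ∈ L` is a primitive
`m`-th root of unity (`L → L_w` is injective). [folklore] -/
private theorem isPrimitiveRoot_algebraMap_zeta_adicCompletion :
    IsPrimitiveRoot (algebraMap L (w.1.adicCompletion L) (IsCyclotomicExtension.zeta m ℚ L)) m :=
  (IsCyclotomicExtension.zeta_spec m ℚ L).map_of_injective
    (algebraMap L (w.1.adicCompletion L)).injective

/-- Every element of `L = ℚ(μ_m)` maps into the `ℚ_v`-subalgebra of `L_w` generated by the `m`-th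
roots of unity of `L_w`. [folklore] -/
private theorem algebraMap_mem_adjoin_rootsOfUnity_adicCompletion (l : L) :
    algebraMap L (w.1.adicCompletion L) l ∈
      Algebra.adjoin (v.adicCompletion ℚ) {b : w.1.adicCompletion L | b ^ m = 1} := by
  have hl : l ∈ Algebra.adjoin ℚ {b : L | b ^ m = 1} :=
    ((IsCyclotomicExtension.iff_singleton m ℚ L).mp inferInstance).2 l
  induction hl using Algebra.adjoin_induction with
  | mem x hx =>
    refine Algebra.subset_adjoin ?_
    change (algebraMap L (w.1.adicCompletion L) x) ^ m = 1
    rw [← map_pow, show x ^ m = 1 from hx, map_one]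
  | algebraMap q =>
    rw [← IsScalarTower.algebraMap_apply ℚ L (w.1.adicCompletion L),
      IsScalarTower.algebraMap_apply ℚ (v.adicCompletion ℚ) (w.1.adicCompletion L)]
    exact Subalgebra.algebraMap_mem _ _
  | add x y _ _ hx hy => rw [map_add]; exact add_mem hx hy
  | mul x y _ _ hx hy => rw [map_mul]; exact mul_mem hx hy

/-- **`L_w = ℚ_v[μ_m]`**: the `m`-th roots of unity of `L_w` generate `L_w` as a `ℚ_v`-algebra.
Proof: the packet's base change `L ⊗[ℚ] ℚ_v → ∏_{w' ∣ v} L_{w'}` is onto, so every element of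
`L_w` is a finite sum `∑ lᵢ · cᵢ` with `lᵢ ∈ L`, `cᵢ ∈ ℚ_v`, and `L ⊆ ℚ_v[μ_m]` by
`algebraMap_mem_adjoin_rootsOfUnity_adicCompletion`.
[cite: NeukirchANT1999, Ch. II §8 p. 161 (L_w = L K_v) and Ch. II (7.12)] -/
theorem adjoin_rootsOfUnity_adicCompletion_eq_top :
    Algebra.adjoin (v.adicCompletion ℚ) {b : w.1.adicCompletion L | b ^ m = 1} = ⊤ := by
  classical
  refine Algebra.eq_top_iff.mpr fun x ↦ ?_
  obtain ⟨t, ht⟩ := (HeightOneSpectrum.adicCompletion.baseChange_bijective ℚ L (𝓞 L) v).2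
    (Pi.single w x)
  have hx : x = HeightOneSpectrum.adicCompletion.baseChange ℚ L (𝓞 L) v t w := by
    rw [ht, Pi.single_eq_same]
  rw [hx]
  clear hx ht
  induction t using TensorProduct.induction_on with
  | zero => rw [map_zero, Pi.zero_apply]; exact zero_mem _
  | tmul l c =>
    rw [HeightOneSpectrum.adicCompletion.baseChange_tmul_apply]
    exact mul_mem (algebraMap_mem_adjoin_rootsOfUnity_adicCompletion L m v w l)
      (Subalgebra.algebraMap_mem _ c)
  | add s t hs ht => rw [map_add, Pi.add_apply]; exact add_mem hs ht

/-- **The completion of a cyclotomic field is a cyclotomic extension of `ℚ_v`:**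
`IsCyclotomicExtension {m} ℚ_v L_w` for every place `w ∣ v` of `L = ℚ(μ_m)` (`L_w = L ℚ_v = ℚ_v(μ_m)`).
[cite: NeukirchANT1999, Ch. II §8 p. 161 (L_w = L K_v) and Ch. II (7.12)] -/
theorem isCyclotomicExtension_adicCompletion :
    IsCyclotomicExtension {m} (v.adicCompletion ℚ) (w.1.adicCompletion L) :=
  (IsCyclotomicExtension.iff_singleton m (v.adicCompletion ℚ) (w.1.adicCompletion L)).mpr
    ⟨⟨_, isPrimitiveRoot_algebraMap_zeta_adicCompletion L m v w⟩, fun x ↦ by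
      rw [adjoin_rootsOfUnity_adicCompletion_eq_top L m v w]; exact Algebra.mem_top⟩

include m in
/-- **`L_w / ℚ_v` is Galois** for every place `w ∣ v` of a cyclotomic field `L = ℚ(μ_m)`
(`m` explicit: the cyclotomic structure is the proof, not the statement).
[cite: NeukirchANT1999, Ch. II (7.12) (ii) and Ch. II §8 p. 161] -/
theorem isGalois_adicCompletion : IsGalois (v.adicCompletion ℚ) (w.1.adicCompletion L) :=
  haveI := isCyclotomicExtension_adicCompletion L m v w
  IsCyclotomicExtension.isGalois {m} (v.adicCompletion ℚ) (w.1.adicCompletion L)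

end Cyclotomic

/-! ## §2 `p ∤ m`: `p` is a uniformiser of `L_w` (`w ∣ p` unramified) -/

section Unramified

variable (L : Type*) [Field L] [NumberField L] (m : ℕ) [NeZero m] [IsCyclotomicExtension {m} ℚ L]
variable (p : ℕ) [hp : Fact p.Prime]

omit [NumberField L] in
/-- A place `w ∋ p` of `L` lies over the prime `(p)` of `ℤ`. [folklore] -/
private theorem liesOver_span_natCast_of_mem (w : HeightOneSpectrum (𝓞 L)) (hw : (p : 𝓞 L) ∈ w.asIdeal) :
    w.asIdeal.LiesOver (Ideal.span {(p : ℤ)}) := by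
  refine ⟨?_⟩
  have hmax : (Ideal.span {(p : ℤ)}).IsMaximal :=
    PrincipalIdealRing.isMaximal_of_irreducible
      (Nat.prime_iff_prime_int.mp hp.out).irreducible
  refine hmax.eq_of_le (Ideal.IsPrime.under ℤ w.asIdeal).ne_top ?_
  rw [Ideal.span_le, Set.singleton_subset_iff]
  change algebraMap ℤ (𝓞 L) (p : ℤ) ∈ w.asIdeal
  rwa [map_natCast]

/-- The extended ideal `(p) 𝓞_L` is `span {p}` and is nonzero. [folklore] -/
private theorem map_span_natCast_eq (hp0 : p ≠ 0 := hp.out.ne_zero) :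
    Ideal.map (algebraMap ℤ (𝓞 L)) (Ideal.span {(p : ℤ)}) = Ideal.span {(p : 𝓞 L)} ∧
      Ideal.span {(p : 𝓞 L)} ≠ ⊥ := by
  refine ⟨by rw [Ideal.map_span, Set.image_singleton, map_natCast], ?_⟩
  rw [Ne, Ideal.span_singleton_eq_bot]
  exact_mod_cast hp0

/-- **`w ∣ p` is unramified in `ℚ(μ_m)` for `p ∤ m`, valuation form:** `v_w(p) = exp (−1)`, i.e.
the rational prime `p` is a uniformiser at every place `w ∋ p` of `L = ℚ(μ_m)`
(`e(w ∣ p) = 1`: Mathlib's `IsCyclotomicExtension.Rat.ramificationIdx_eq_of_not_dvd`).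
[cite: NeukirchANT1999, Ch. I (10.3)–(10.4)] -/
theorem intValuation_natCast_eq_exp_neg_one_of_not_dvd (hm : ¬ p ∣ m)
    (w : HeightOneSpectrum (𝓞 L)) (hw : (p : 𝓞 L) ∈ w.asIdeal) :
    w.intValuation (p : 𝓞 L) = WithZero.exp (-1 : ℤ) := by
  haveI := liesOver_span_natCast_of_mem L p w hw
  have hp0 : (p : 𝓞 L) ≠ 0 := by exact_mod_cast hp.out.ne_zero
  obtain ⟨hmap, hne⟩ := map_span_natCast_eq L p
  have he : w.asIdeal.ramificationIdx ℤ = 1 :=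
    IsCyclotomicExtension.Rat.ramificationIdx_eq_of_not_dvd p L w.asIdeal hm
  rw [Ideal.IsDedekindDomain.ramificationIdx_eq_multiplicity (Ideal.span {(p : ℤ)}) w.asIdeal
      (by rwa [hmap]), hmap] at he
  rw [HeightOneSpectrum.intValuation_eq_exp_neg_multiplicity w hp0, he, Nat.cast_one]

/-- The same in `L_w`: **`v_w((p : L_w)) = exp (−1)`** for `p ∤ m` and `w ∋ p` (`L_w / ℚ_p` is
unramified: `p` is a uniformiser). [cite: NeukirchANT1999, Ch. II (7.12) (i)] -/
theorem valued_natCast_adicCompletion_eq_exp_neg_one_of_not_dvd (hm : ¬ p ∣ m)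
    (w : HeightOneSpectrum (𝓞 L)) (hw : (p : 𝓞 L) ∈ w.asIdeal) :
    Valued.v ((p : ℕ) : w.adicCompletion L) = WithZero.exp (-1 : ℤ) := by
  have h1 : ((p : ℕ) : w.adicCompletion L) =
      algebraMap L (w.adicCompletion L) (algebraMap (𝓞 L) L (p : 𝓞 L)) := by
    rw [map_natCast, map_natCast]
  rw [h1, show algebraMap L (w.adicCompletion L) (algebraMap (𝓞 L) L (p : 𝓞 L)) =
      ((algebraMap (𝓞 L) L (p : 𝓞 L) : L) : w.adicCompletion L) from rfl,
    HeightOneSpectrum.valuedAdicCompletion_eq_valuation' w, HeightOneSpectrum.valuation_of_algebraMap,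
    intValuation_natCast_eq_exp_neg_one_of_not_dvd L m p hm w hw]

/-- In the value group `ℤᵐ⁰` of `L_w`, an element `< 1` is `≤ exp (−1)`. [folklore] -/
private theorem valued_le_exp_neg_one_of_lt_one (w : HeightOneSpectrum (𝓞 L)) (x : w.adicCompletion L)
    (hx : Valued.v x < 1) : Valued.v x ≤ WithZero.exp (-1 : ℤ) := by
  by_cases h0 : Valued.v x = 0
  · rw [h0]; exact zero_le
  · rw [← WithZero.exp_log h0, WithZero.exp_le_exp]
    rw [← WithZero.exp_log h0, ← WithZero.exp_zero, WithZero.exp_lt_exp] at hx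
    omega

/-- **The unramifiedness hypothesis of the K-port, `Valued` form:** for `p ∤ m` and a place
`w ∋ p` of `L = ℚ(μ_m)`, every `x : L_w` with `v_w(x) < 1` has `v_w(x) ≤ v_w(p)` — the value group
of `L_w` is generated by the value of `p` (this is the hypothesis
`hK : ∀ x, ‖x‖ < 1 → ‖x‖ ≤ ‖(p : K)‖` of `Summit.…Theorems.KPort.consumer_of_addv`, for any norm
inducing the `w`-adic topology with the same unit ball). [cite: NeukirchANT1999, Ch. II (7.12) (i)] -/
theorem valued_le_valued_natCast_of_lt_one_of_not_dvd (hm : ¬ p ∣ m)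
    (w : HeightOneSpectrum (𝓞 L)) (hw : (p : 𝓞 L) ∈ w.asIdeal) (x : w.adicCompletion L)
    (hx : Valued.v x < 1) : Valued.v x ≤ Valued.v ((p : ℕ) : w.adicCompletion L) := by
  rw [valued_natCast_adicCompletion_eq_exp_neg_one_of_not_dvd L m p hm w hw]
  exact valued_le_exp_neg_one_of_lt_one L w x hx

/-! ### `Extension` forms at the place `v_p = primesEquiv.symm p` of `ℚ` -/

/-- A place of `L` above `v_p` contains `p`. [folklore] -/
private theorem natCast_mem_asIdeal_of_extension
    (w : ((Rat.HeightOneSpectrum.primesEquiv (R := 𝓞 ℚ)).symm ⟨p, hp.out⟩).Extension (𝓞 L)) :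
    (p : 𝓞 L) ∈ w.1.asIdeal := by
  -- `p ∈ v_p`
  have hgen : Rat.HeightOneSpectrum.natGenerator
      ((Rat.HeightOneSpectrum.primesEquiv (R := 𝓞 ℚ)).symm ⟨p, hp.out⟩) = p :=
    congrArg Subtype.val ((Rat.HeightOneSpectrum.primesEquiv (R := 𝓞 ℚ)).apply_symm_apply ⟨p, hp.out⟩)
  have hpv : (p : 𝓞 ℚ) ∈ ((Rat.HeightOneSpectrum.primesEquiv (R := 𝓞 ℚ)).symm ⟨p, hp.out⟩).asIdeal := by
    have h : Rat.HeightOneSpectrum.natGenerator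
        ((Rat.HeightOneSpectrum.primesEquiv (R := 𝓞 ℚ)).symm ⟨p, hp.out⟩) ∣ p := by rw [hgen]
    rwa [Rat.HeightOneSpectrum.natGenerator_dvd_iff,
      ← map_natCast (Rat.IsIntegralClosure.intEquiv (𝓞 ℚ)) p, Ideal.apply_mem_of_equiv_iff] at h
  -- `v_p = w ∩ 𝓞 ℚ`
  have hunder : w.1.asIdeal.under (𝓞 ℚ) =
      ((Rat.HeightOneSpectrum.primesEquiv (R := 𝓞 ℚ)).symm ⟨p, hp.out⟩).asIdeal := by
    rw [← HeightOneSpectrum.under_asIdeal (𝓞 ℚ) w.1, w.2]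
  rw [← hunder, Ideal.under_def, Ideal.mem_comap, map_natCast] at hpv
  exact hpv

/-- `Extension` form of `valued_natCast_adicCompletion_eq_exp_neg_one_of_not_dvd`: at every place
`w` of `L = ℚ(μ_m)` above `v_p`, `p ∤ m`, **`v_w(p) = exp (−1)`**.
[cite: NeukirchANT1999, Ch. II (7.12) (i)] -/
theorem valued_natCast_adicCompletion_extension_eq_exp_neg_one (hm : ¬ p ∣ m)
    (w : ((Rat.HeightOneSpectrum.primesEquiv (R := 𝓞 ℚ)).symm ⟨p, hp.out⟩).Extension (𝓞 L)) :
    Valued.v ((p : ℕ) : w.1.adicCompletion L) = WithZero.exp (-1 : ℤ) :=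
  valued_natCast_adicCompletion_eq_exp_neg_one_of_not_dvd L m p hm w.1
    (natCast_mem_asIdeal_of_extension L p w)

/-- `Extension` form of the K-port unramifiedness hypothesis: at every place `w` of `L = ℚ(μ_m)`
above `v_p`, `p ∤ m`, **`v_w(x) < 1 → v_w(x) ≤ v_w(p)`**. [cite: NeukirchANT1999, Ch. II (7.12) (i)] -/
theorem valued_le_valued_natCast_of_lt_one_extension (hm : ¬ p ∣ m)
    (w : ((Rat.HeightOneSpectrum.primesEquiv (R := 𝓞 ℚ)).symm ⟨p, hp.out⟩).Extension (𝓞 L))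
    (x : w.1.adicCompletion L) (hx : Valued.v x < 1) :
    Valued.v x ≤ Valued.v ((p : ℕ) : w.1.adicCompletion L) :=
  valued_le_valued_natCast_of_lt_one_of_not_dvd L m p hm w.1 (natCast_mem_asIdeal_of_extension L p w)
    x hx

end Unramified

/-! ## §3 The consumers' currency `L = CyclotomicField m ℚ`

The tree's consumers (`Summit.…GaloisImage.KatoExpStarFiniteLevelAt`, the registered stub `hKloc` of
crux `KatoKuriharaPortThreeShared`) work with `CyclotomicField (cycLevel 3 0 r) ℚ`.  Mathlib's instance
`CyclotomicField.isCyclotomicExtension m ℚ` is found for the binder `[IsCyclotomicExtension {m} ℚ L]`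
only with `backward.isDefEq.respectTransparency false` (the `ℚ`-algebra structure of the splitting
field vs. `DivisionRing.toRatAlgebra` — the same device as in `KatoExpStarFiniteLevel.lean`), so the
four statements are re-exported here at `L = CyclotomicField m ℚ` with the instance discharged. -/

section CyclotomicField

variable (m : ℕ) [NeZero m]

set_option backward.isDefEq.respectTransparency false in
/-- `ℚ(ζ_m)_w / ℚ_v` is a cyclotomic extension, `L = CyclotomicField m ℚ`.
[cite: NeukirchANT1999, Ch. II §8 p. 161 (L_w = L K_v) and Ch. II (7.12)] -/
theorem isCyclotomicExtension_adicCompletion_cyclotomicField (v : HeightOneSpectrum (𝓞 ℚ))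
    (w : v.Extension (𝓞 (CyclotomicField m ℚ))) :
    IsCyclotomicExtension {m} (v.adicCompletion ℚ) (w.1.adicCompletion (CyclotomicField m ℚ)) :=
  isCyclotomicExtension_adicCompletion (CyclotomicField m ℚ) m v w

set_option backward.isDefEq.respectTransparency false in
/-- **`ℚ(ζ_m)_w / ℚ_v` is Galois**, `L = CyclotomicField m ℚ` — the `IsGalois` input of the K-port
consumer at the factor fields of `hKloc`. [cite: NeukirchANT1999, Ch. II (7.12) (ii) and Ch. II §8 p. 161] -/
theorem isGalois_adicCompletion_cyclotomicField (v : HeightOneSpectrum (𝓞 ℚ))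
    (w : v.Extension (𝓞 (CyclotomicField m ℚ))) :
    IsGalois (v.adicCompletion ℚ) (w.1.adicCompletion (CyclotomicField m ℚ)) :=
  isGalois_adicCompletion (CyclotomicField m ℚ) m v w

set_option backward.isDefEq.respectTransparency false in
/-- **`v_w(p) = exp (−1)`** at every place `w ∣ p` of `CyclotomicField m ℚ`, `p ∤ m`.
[cite: NeukirchANT1999, Ch. I (10.3)–(10.4) and Ch. II (7.12) (i)] -/
theorem valued_natCast_adicCompletion_cyclotomicField_eq_exp_neg_one (p : ℕ) [hp : Fact p.Prime]
    (hm : ¬ p ∣ m)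
    (w : ((Rat.HeightOneSpectrum.primesEquiv (R := 𝓞 ℚ)).symm ⟨p, hp.out⟩).Extension
      (𝓞 (CyclotomicField m ℚ))) :
    Valued.v ((p : ℕ) : w.1.adicCompletion (CyclotomicField m ℚ)) = WithZero.exp (-1 : ℤ) :=
  valued_natCast_adicCompletion_extension_eq_exp_neg_one (CyclotomicField m ℚ) m p hm w

set_option backward.isDefEq.respectTransparency false in
/-- **The K-port unramifiedness hypothesis** at every place `w ∣ p` of `CyclotomicField m ℚ`,
`p ∤ m`: `v_w(x) < 1 → v_w(x) ≤ v_w(p)`. [cite: NeukirchANT1999, Ch. II (7.12) (i)] -/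
theorem valued_le_valued_natCast_of_lt_one_cyclotomicField (p : ℕ) [hp : Fact p.Prime]
    (hm : ¬ p ∣ m)
    (w : ((Rat.HeightOneSpectrum.primesEquiv (R := 𝓞 ℚ)).symm ⟨p, hp.out⟩).Extension
      (𝓞 (CyclotomicField m ℚ)))
    (x : w.1.adicCompletion (CyclotomicField m ℚ)) (hx : Valued.v x < 1) :
    Valued.v x ≤ Valued.v ((p : ℕ) : w.1.adicCompletion (CyclotomicField m ℚ)) :=
  valued_le_valued_natCast_of_lt_one_extension (CyclotomicField m ℚ) m p hm w x hx

end CyclotomicField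

end Literature.NumberTheory.AdelicBaseChange

end
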